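import Summits.ResolutionOfSingularities.ResolutionOfSingularities.Theorems.PurelyInseparableDim4LoopCLocalEscape
import Summits.ResolutionOfSingularities.ResolutionOfSingularities.Theorems.PurelyInseparableDim4KeptMultiplicity
import Summits.ResolutionOfSingularities.ResolutionOfSingularities.Theorems.PurelyInseparableDim4TrapBaseChange
import Summits.ResolutionOfSingularities.ResolutionOfSingularities.Theorems.PurelyInseparableDim4ScopeBaseChange
import HarnessLib

/-!
# [OURS · res-dim4-pi · F4-C] UNIFORM NO-REPLY WITNESSES: `decide`-able certificates on a presented state over a
  small field that rule out equimultiple replies over EVERY field extension and at EVERY point of a given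
  translation class — the tool that lifts the «`𝔽_p`-rational replies only» rider

Cell `res-dim4-pi` (D-0157 DOOR 2, wave 2), seat `res-dim4-p-6` g2.  The cell's win certificates (p-14's
`iwinCertB`, p-13's `BandWin*`, the seat's `rwinCertB`) enumerate B's replies over a FINITE field; over a larger
field B has more points.  Two symbolic facts close the gap whenever they apply:

* §1 base change of the point transform at an ARBITRARY point: `chartTransform_map`,
  `pointTransform_baseChange` — for `f : k →+* K` and any `b : Fin 4 → K`,
  `pointTransform q S j b ⟨map f F, r, exc⟩ = translate b (map f (chartTransform q S j F))`.
* §2 **MAXIMAL WITNESS** `uniformWitnessB q S j T L γ` (Bool, on term lists over `k`): `γ ≠ 0`, `|γ| < q`, the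
  coefficient of `x^γ` in the chart transform is non-zero, and `γ` is MAXIMAL in its translation class for the
  translated coordinates `T` (no other exponent `e ≥ γ` of the chart transform agrees with `γ` off `T`).
  Soundness **`coeff_pointTransform_of_uniformWitnessB`** / **`not_isEquimultiplePoint_of_uniformWitnessB`**: for
  EVERY field `K`, every `f : k →+* K` and EVERY point `b` vanishing off `T`, the coefficient of `x^γ` in the point
  transform is `f (coeff)` (g0's `KeptMultiplicity.coeff_translate_eq_coeff_of_maximal`: an undominated monomial
  keeps its coefficient under translation), so the point is NOT equimultiple.
* §3 **SINGLE SOURCE** `singleSourceB q S j T L γ e`: `x^γ` (`|γ| < q`, `γ ≠ 0`) is produced under `T`-translations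
  by exactly ONE monomial `x^e` of the chart transform; then **`coeff_pointTransform_of_singleSourceB`** gives the
  closed form `coeff_γ = f(c_e) · ∏ᵢ C(eᵢ,γᵢ) bᵢ^{eᵢ−γᵢ}` (tree `WeightedBlowup.coeff_translate_monomial`), so
  equimultiplicity forces an explicit product of powers of the `bᵢ` to vanish
  (**`prod_eq_zero_of_isEquimultiplePoint_of_singleSourceB`**).
* §4 the rational replies: `step_baseChange_zero` (the chart-origin reply commutes with base change, from
  `BaseChange.step_map`); permissibility and scope go up by the tree's `BaseChange.isPermissibleCentre_map_iff` /
  `ScopeBaseChange.inCoordinateScope_map`.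

Consumers: `…LoopCLocalEscapeUniform` (this seat: the LOOP-C local escape over EVERY field of characteristic 3);
any `𝔽₂` W-batch row whose replies all carry maximal witnesses lifts to all fields of characteristic 2 the same way.
Scope (honest): a sufficient symbolic criterion; rows whose low-degree coefficients genuinely depend on `b` need §3 or
a finer argument.  [OURS · counted 0 · elementary; AI kernel work, weaker than expert review.]  NOTHING here is a
statement about resolution of singularities; resolution in dimension `≥ 4` / characteristic `p > 0` is NOT proved by
anything in this file.  bears_on: LADDER-RESOLUTION:D157-DOOR2 (res-dim4-pi · F4-C all-fields replies).  Host item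
(DR-157-C): `stmt-ResolutionOfSingularities-16155`, helper.
-/

set_option linter.dupNamespace false -- mandated namespace of this single-conjunct summit

noncomputable section

open MvPolynomial Finset
open scoped BigOperators

namespace Summit.ResolutionOfSingularities.ResolutionOfSingularities.Theorems.PIDim4

namespace UniformNoReply

open Literature.AlgebraicGeometry.Resolution
open Literature.AlgebraicGeometry.Resolution.Hauser2010
open Literature.AlgebraicGeometry.Resolution.CentreBlowup
open StepKit

variable {k K : Type} [Field k] [Field K] [DecidableEq k] [DecidableEq K] (f : k →+* K)

/-! ## §1 Base change of the point transform at an arbitrary point -/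

omit [DecidableEq k] [DecidableEq K] in
/-- The chart transform commutes with the coefficient map. OURS (as the tree's private
`CentreBlowup.map_chartTransform`, for a ring homomorphism). [folklore] -/
theorem chartTransform_map (q : ℕ) (S : Finset (Fin 4)) (j : Fin 4) (F : MvPolynomial (Fin 4) k) :
    chartTransform q S j (MvPolynomial.map f F) = MvPolynomial.map f (chartTransform q S j F) := by
  unfold chartTransform
  rw [map_sum, support_map_of_injective F f.injective]
  refine Finset.sum_congr rfl fun d _ => ?_
  rw [map_monomial, coeff_map]

omit [DecidableEq k] [DecidableEq K] in
/-- **The point transform of a base-changed state at an ARBITRARY point `b ∈ K⁴`**: translate the mapped chart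
transform. OURS. [folklore] -/
theorem pointTransform_baseChange (q : ℕ) (S : Finset (Fin 4)) (j : Fin 4) (b : Fin 4 → K) (s : State k) :
    pointTransform q S j b (⟨MvPolynomial.map f s.F, s.r, s.exc⟩ : State K) =
      PointBlowup.translate b (MvPolynomial.map f (chartTransform q S j s.F)) := by
  unfold pointTransform
  rw [chartTransform_map]

omit [DecidableEq k] [DecidableEq K] in
/-- For a presented state: the mapped chart transform is the mapped evaluation of `chartL`. OURS. [folklore] -/
theorem pointTransform_baseChange_evalT (q : ℕ) (S : Finset (Fin 4)) (j : Fin 4) (b : Fin 4 → K)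
    (s : SData 4 k) :
    pointTransform q S j b (⟨MvPolynomial.map f s.toState.F, s.toState.r, s.toState.exc⟩ : State K) =
      PointBlowup.translate b (MvPolynomial.map f (evalT (chartL q S j s.L))) := by
  rw [pointTransform_baseChange, SData.toState_F, chartTransform_evalT]

/-! ## §2 Maximal witnesses: an undominated low-degree monomial survives every translation -/

/-- **Maximal no-reply witness** for the chart `j` of the blow-up of `C_S`, translated coordinates `T`:
`γ ≠ 0`, `|γ| < q`, `coeff_γ` of the chart transform `≠ 0`, and no other exponent `e ≥ γ` of the chart transform
agrees with `γ` off `T`. OURS. [folklore] -/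
def uniformWitnessB (q : ℕ) (S : Finset (Fin 4)) (j : Fin 4) (T : Finset (Fin 4)) (L : Terms 4 k)
    (γ : Fin 4 → ℕ) : Bool :=
  !decide (γ = 0) && decide (∑ i, γ i < q) && !decide (coeffAt (chartL q S j L) γ = 0) &&
    (live (chartL q S j L)).all fun e =>
      decide ((∀ i, γ i ≤ e i) → (∀ m, m ∉ T → γ m = e m) → e = γ)

omit [DecidableEq K] in
/-- **The witness coefficient survives**: over every field `K ⊇ f(k)` and at every point `b` vanishing off `T`,
`coeff_{x^γ}` of the point transform of the base-changed state is `f` of the `k`-coefficient. OURS. [folklore] -/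
theorem coeff_pointTransform_of_uniformWitnessB {q : ℕ} {S T : Finset (Fin 4)} {j : Fin 4} {s : SData 4 k}
    {γ : Fin 4 → ℕ} (h : uniformWitnessB q S j T s.L γ = true) {b : Fin 4 → K}
    (hb : ∀ m, m ∉ T → b m = 0) :
    coeff (expo γ) (pointTransform q S j b
        (⟨MvPolynomial.map f s.toState.F, s.toState.r, s.toState.exc⟩ : State K)) =
      f (coeffAt (chartL q S j s.L) γ) := by
  simp only [uniformWitnessB, Bool.and_eq_true, Bool.not_eq_true', decide_eq_false_iff_not,
    decide_eq_true_eq, List.all_eq_true] at h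
  obtain ⟨⟨⟨-, -⟩, -⟩, hmax⟩ := h
  rw [pointTransform_baseChange_evalT]
  rw [KeptMultiplicity.coeff_translate_eq_coeff_of_maximal b _ ?_, coeff_map, coeff_expo_evalT]
  intro e he hle hagree
  have he' : e ∈ (evalT (chartL q S j s.L)).support := support_map_subset _ _ he
  rw [mem_support_evalT_iff] at he'
  have key := hmax (⇑e) he' (fun i => by simpa using hle i) (fun m hm => by
    have := hagree m (hb m hm); simpa using this)
  exact (expo_eq_iff.mpr key.symm).symm

omit [DecidableEq K] in
/-- **UNIFORM NO-REPLY**: with a maximal witness, NO point `b` vanishing off `T` of the `x_j`-chart is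
equimultiple — over EVERY field `K` and for EVERY such `K`-point, not only the `k`-rational ones. OURS. [folklore] -/
theorem not_isEquimultiplePoint_of_uniformWitnessB {q : ℕ} {S T : Finset (Fin 4)} {j : Fin 4}
    {s : SData 4 k} {γ : Fin 4 → ℕ} (h : uniformWitnessB q S j T s.L γ = true) {b : Fin 4 → K}
    (hb : ∀ m, m ∉ T → b m = 0) :
    ¬ IsEquimultiplePoint q S j b
      (⟨MvPolynomial.map f s.toState.F, s.toState.r, s.toState.exc⟩ : State K) := by
  have hcoeff := coeff_pointTransform_of_uniformWitnessB f h hb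
  simp only [uniformWitnessB, Bool.and_eq_true, Bool.not_eq_true', decide_eq_false_iff_not,
    decide_eq_true_eq, List.all_eq_true] at h
  obtain ⟨⟨⟨h0, hdeg⟩, hc⟩, -⟩ := h
  intro heq
  have hz := heq (expo γ) ((not_congr (expo_eq_zero_iff γ)).mpr h0) (by rw [degree_expo]; exact hdeg)
  rw [hcoeff, map_eq_zero_iff f f.injective] at hz
  exact hc hz

/-! ## §3 Single sources: the closed form of a low-degree coefficient -/

/-- **Single-source certificate**: `γ ≠ 0`, `|γ| < q`, `e` a live exponent of the chart transform with `γ ≤ e`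
agreeing with `γ` off `T`, and the ONLY such exponent. OURS. [folklore] -/
def singleSourceB (q : ℕ) (S : Finset (Fin 4)) (j : Fin 4) (T : Finset (Fin 4)) (L : Terms 4 k)
    (γ e : Fin 4 → ℕ) : Bool :=
  !decide (γ = 0) && decide (∑ i, γ i < q) && decide (e ∈ live (chartL q S j L)) &&
    decide (∀ i, γ i ≤ e i) && decide (∀ m, m ∉ T → γ m = e m) &&
    (live (chartL q S j L)).all fun e' =>
      decide ((∀ i, γ i ≤ e' i) → (∀ m, m ∉ T → γ m = e' m) → e' = e)

omit [DecidableEq K] in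
/-- **Closed form of a single-source coefficient**: at every point `b` vanishing off `T` (every field),
`coeff_{x^γ}` of the point transform `= f(c_e) · ∏ᵢ C(eᵢ,γᵢ)·bᵢ^{eᵢ−γᵢ}`. OURS (tree
`WeightedBlowup.coeff_translate_monomial` on the unique source, the other monomials contribute nothing by
`PointBlowup.le_of/apply_eq_of_coeff_translate_monomial_ne_zero`). [folklore] -/
theorem coeff_pointTransform_of_singleSourceB {q : ℕ} {S T : Finset (Fin 4)} {j : Fin 4} {s : SData 4 k}
    {γ e : Fin 4 → ℕ} (h : singleSourceB q S j T s.L γ e = true) {b : Fin 4 → K}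
    (hb : ∀ m, m ∉ T → b m = 0) :
    coeff (expo γ) (pointTransform q S j b
        (⟨MvPolynomial.map f s.toState.F, s.toState.r, s.toState.exc⟩ : State K)) =
      f (coeffAt (chartL q S j s.L) e) * ∏ i, (((e i).choose (γ i) : K) * b i ^ (e i - γ i)) := by
  simp only [singleSourceB, Bool.and_eq_true, Bool.not_eq_true', decide_eq_false_iff_not,
    decide_eq_true_eq, List.all_eq_true] at h
  obtain ⟨⟨⟨⟨⟨-, -⟩, helive⟩, -⟩, -⟩, huniq⟩ := h
  rw [pointTransform_baseChange_evalT]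
  set P : MvPolynomial (Fin 4) K := MvPolynomial.map f (evalT (chartL q S j s.L)) with hP
  have hvanish : ∀ e' ∈ P.support, e' ≠ expo e →
      coeff (expo γ) (PointBlowup.translate b (monomial e' (coeff e' P))) = 0 := by
    intro e' he' hne
    by_contra hc
    have hle := PointBlowup.le_of_coeff_translate_monomial_ne_zero b hc
    have hagree := fun m (hm : b m = 0) => PointBlowup.apply_eq_of_coeff_translate_monomial_ne_zero b hm hc
    have he'' : e' ∈ (evalT (chartL q S j s.L)).support := support_map_subset _ _ he'
    rw [mem_support_evalT_iff] at he''
    have key := huniq (⇑e') he'' (fun i => by simpa using hle i) (fun m hm => by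
      have := hagree m (hb m hm); simpa using this)
    exact hne ((expo_eq_iff.mpr key.symm).symm)
  have hcoeffe : coeff (expo e) P = f (coeffAt (chartL q S j s.L) e) := by
    rw [hP, coeff_map, coeff_expo_evalT]
  rw [PointBlowup.translate_eq_sum_support, coeff_sum]
  by_cases hmem : expo e ∈ P.support
  · rw [Finset.sum_eq_single (expo e) (fun e' he' hne => hvanish e' he' hne) (fun h => (h hmem).elim),
      WeightedBlowup.coeff_translate_monomial, hcoeffe]
    rfl
  · -- impossible: `e` is live and `f` is injective
    exfalso
    apply hmem
    rw [MvPolynomial.mem_support_iff, hcoeffe, map_ne_zero_iff f f.injective]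
    have := (expo_mem_support_iff (chartL q S j s.L) e).mpr helive
    rwa [MvPolynomial.mem_support_iff, coeff_expo_evalT] at this

omit [DecidableEq K] in
/-- **Equimultiplicity at a single-source point kills the product**: `∏ᵢ C(eᵢ,γᵢ)·bᵢ^{eᵢ−γᵢ} = 0` — an explicit
polynomial condition on the free coordinates of `b`. OURS. [folklore] -/
theorem prod_eq_zero_of_isEquimultiplePoint_of_singleSourceB {q : ℕ} {S T : Finset (Fin 4)} {j : Fin 4}
    {s : SData 4 k} {γ e : Fin 4 → ℕ} (h : singleSourceB q S j T s.L γ e = true) {b : Fin 4 → K}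
    (hb : ∀ m, m ∉ T → b m = 0)
    (heq : IsEquimultiplePoint q S j b
      (⟨MvPolynomial.map f s.toState.F, s.toState.r, s.toState.exc⟩ : State K)) :
    ∏ i, (((e i).choose (γ i) : K) * b i ^ (e i - γ i)) = 0 := by
  have hcoeff := coeff_pointTransform_of_singleSourceB f h hb
  simp only [singleSourceB, Bool.and_eq_true, Bool.not_eq_true', decide_eq_false_iff_not,
    decide_eq_true_eq, List.all_eq_true] at h
  obtain ⟨⟨⟨⟨⟨h0, hdeg⟩, helive⟩, -⟩, -⟩, -⟩ := h
  have hz := heq (expo γ) ((not_congr (expo_eq_zero_iff γ)).mpr h0) (by rw [degree_expo]; exact hdeg)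
  rw [hcoeff] at hz
  rcases mul_eq_zero.mp hz with h1 | h2
  · exfalso
    rw [map_eq_zero_iff f f.injective] at h1
    have := (expo_mem_support_iff (chartL q S j s.L) e).mpr helive
    rw [MvPolynomial.mem_support_iff, coeff_expo_evalT] at this
    exact this h1
  · exact h2

/-! ## §4 The rational replies and the legality data go up -/

/-- **The chart-origin reply commutes with base change** (`BaseChange.step_map` at `b = 0`). OURS. [folklore] -/
theorem step_baseChange_zero (q : ℕ) (S : Finset (Fin 4)) (j : Fin 4) (s : State k) :
    CentreBlowup.step q S j (0 : Fin 4 → K) (⟨MvPolynomial.map f s.F, s.r, s.exc⟩ : State K) =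
      ⟨MvPolynomial.map f (CentreBlowup.step q S j (0 : Fin 4 → k) s).F,
        (CentreBlowup.step q S j (0 : Fin 4 → k) s).r, (CentreBlowup.step q S j (0 : Fin 4 → k) s).exc⟩ := by
  have h := BaseChange.step_map f q S j (0 : Fin 4 → k) s
  rwa [ScopeBaseChange.comp_zero f] at h

end UniformNoReply

end Summit.ResolutionOfSingularities.ResolutionOfSingularities.Theorems.PIDim4

end
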